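import Summits.HodgeConjecture.HodgeConjecture.Theorems.Q8MonodromyBireflectionLocalConfiguration
import Literature.Geometry.ComplexAnalytic.PhamBrieskornA3BallPieceMV
import HarnessLib

/-!
# K1Q stub S5 (v6) at a point, from the geometric monodromy and the Mayer–Vietoris description of the two ball pieces

Sub-problem `HodgeConjecture`, route `Summits/HodgeConjecture/HodgeConjecture/Theses/Q8SymplecticPowers.lean` (crux K1Q
`VeryGeneralQuaternionCommutatorsInHg`, stmt-HodgeConjecture-24190, stub S5 `stub_monodromyBireflectionQ`, skeleton v6). Written by the prover
seat `hodge-nonav-prover-Ax` (g18). HC ∕ HC_AV ∕ K1Q are NOT proved here.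

`monodromyBireflection_of_localConfigurationMV` = `monodromyBireflection_of_localConfiguration` (model-free, p730948) with its three local
homological hypotheses and the finiteness of `H₂` of the pieces DISCHARGED from the expected geometry of a ball piece `A_k` at a d6 point:
an open cover `A_k = U_k ∪ V_k` with `H₁ = H₂ = 0` (over `ℚ`) on `U_k ∩ V_k` (two punctured disc bundles ≃ `ℝP³ × ℝ`), `τ² = +1` on
`H₂(V_k; ℚ)` (`V_k` a neighbourhood of the exceptional curves `E_±`), and `U_k = A_k ∖ (E₊ ∪ E₋)` modelled ON HOMOLOGY on the free quotient
`F°∕ι` of the punctured `A₃` Milnor fibre by a homeomorphism `e_k` with `(e₁ ∘ h|)_* = (h̄ ∘ e₁)_*`, `(e₁ ∘ τ|)_* = (τ̄ ∘ e₁)_*`,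
`(e₂ ∘ h|)_* = (h̄ ∘ e₂)_*`, `(e₂ ∘ τ³|)_* = (τ̄ ∘ e₂)_*` (`Literature…PhamBrieskornA3BallPieceMV`). With
`Q8MonodromyBireflectionTransport.clause_transport_family_of_pathConnected` and
`Q8SymplecticPowersRegularOfOneFibre.pathConnectedSpace_complexPoints_base` the clause then holds at every point of the base.
What remains: producing this geometric datum at one point of the base (memo `LOC6-ARCHITECTURE-Ax-g18.md` §8 (G)).
-/

noncomputable section

set_option backward.isDefEq.respectTransparency false
set_option linter.dupNamespace false

open Module LinearMap CategoryTheory CategoryTheory.Limits Set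
open scoped TensorProduct
open Literature.AlgebraicTopology.SingularHomology Literature.AlgebraicGeometry Literature.AlgebraicGeometry.Motives
open Literature.AlgebraicGeometry.HodgeTheory Literature.AlgebraicGeometry.HodgeTheory.BettiUniverse
open Literature.Geometry.ComplexAnalytic Literature.Geometry.ComplexAnalytic.PhamBrieskorn

namespace Summit.HodgeConjecture.HodgeConjecture.Theorems.Q8MonodromyBireflectionAssembly

attribute [local instance] OrbitSpace.homeoMulAction

variable {𝒳 S : SchemeOver ℂ} (π : 𝒳 ⟶ S) {τ : 𝒳 ⟶ 𝒳} (hτπ : τ ≫ π = π)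

/-- **K1Q stub S5 (v6) at a point `s` from the geometric monodromy and the Mayer–Vietoris description of the two ball pieces** (see the
module docstring). [cite: VoisinHodgeII2003, §3.1.2 and §3.2.1] [cite: Milnor1968, §9 Thm. 9.1] [cite: HatcherAT2002, §2.2 p. 149] -/
theorem monodromyBireflection_of_localConfigurationMV {ζ : ℂ} (hζ : IsPrimitiveRoot ζ 4) (hπ : IsSmoothProjectiveFamily π 2) (h𝒳 : IsQuasiProjectiveOver 𝒳)
    (hS : IsQuasiProjectiveOver S) {j : 𝒳 ⟶ 𝒳} (hjπ : j ≫ π = π) (h4 : τ ≫ τ ≫ τ ≫ τ = 𝟙 𝒳) (hjj : j ≫ j = τ ≫ τ)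
    (hτjτ : τ ≫ j ≫ τ = j) (hU : IsCohomologicallyLocallyTrivialOn π (Set.univ : Set (ComplexPoints S))) (s : ComplexPoints S)
    (γ : bettiCohomology (fiberOver π s) 2 ≃ₗ[ℚ] bettiCohomology (fiberOver π s) 2)
    (hγΓ : γ ∈ ratMonodromyGroup π 2 hU ⟨s, Set.mem_univ s⟩)
    (hγ1 : ∃ a, pull (fiberOverEnd π τ hτπ s) 2 (pull (fiberOverEnd π τ hτπ s) 2 a) = -a ∧ γ a ≠ a)
    (h : ComplexPoints (fiberOver π s) ≃ₜ ComplexPoints (fiberOver π s))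
    (hγh : ∀ a, γ a = (singularCohomology.map ℚ ℚ (h : C(ComplexPoints (fiberOver π s), ComplexPoints (fiberOver π s))) 2).hom a)
    (hhμ : singularHomology.map ℚ ℚ (h : C(ComplexPoints (fiberOver π s), ComplexPoints (fiberOver π s))) 4
      (complexOrientationRat (hπ.isSmoothProjective s)).fundamentalClass = (complexOrientationRat (hπ.isSmoothProjective s)).fundamentalClass)
    (hhτ : ∀ x, h (AlgPoints.mapContinuous (L := ℂ) (fiberOverEnd π τ hτπ s) x) = AlgPoints.mapContinuous (L := ℂ) (fiberOverEnd π τ hτπ s) (h x))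
    {A₁ A₂ B : Set (ComplexPoints (fiberOver π s))} (h1o : IsOpen A₁) (h2o : IsOpen A₂) (hBo : IsOpen B) (hcov : A₁ ∪ A₂ ∪ B = univ)
    (hdisj : Disjoint (closure A₁) A₂) (hB : ∀ x ∈ B, h x = x)
    (hhA₁ : MapsTo (h : C(ComplexPoints (fiberOver π s), ComplexPoints (fiberOver π s))) A₁ A₁)
    (hhA₂ : MapsTo (h : C(ComplexPoints (fiberOver π s), ComplexPoints (fiberOver π s))) A₂ A₂)
    (hτA₁ : MapsTo (AlgPoints.mapContinuous (L := ℂ) (fiberOverEnd π τ hτπ s)) A₁ A₁)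
    (hτA₂ : MapsTo (AlgPoints.mapContinuous (L := ℂ) (fiberOverEnd π τ hτπ s)) A₂ A₂)
    (hjA₁ : MapsTo (AlgPoints.mapContinuous (L := ℂ) (fiberOverEnd π j hjπ s)) A₁ A₂)
    (hjA₂ : MapsTo (AlgPoints.mapContinuous (L := ℂ) (fiberOverEnd π j hjπ s)) A₂ A₁)
    {U₁ V₁ : Set ↥A₁} (hUo₁ : IsOpen U₁) (hVo₁ : IsOpen V₁) (hUV₁ : U₁ ∪ V₁ = univ)
    (hI₁₁ : IsZero (singularHomology ℚ ℚ ↥(U₁ ∩ V₁) 2)) (hI₀₁ : IsZero (singularHomology ℚ ℚ ↥(U₁ ∩ V₁) 1))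
    (hsU₁ : MapsTo (singularHomology.restrictSelf (AlgPoints.mapContinuous (L := ℂ) (fiberOverEnd π τ hτπ s)) hτA₁) U₁ U₁) (hsV₁ : MapsTo (singularHomology.restrictSelf (AlgPoints.mapContinuous (L := ℂ) (fiberOverEnd π τ hτπ s)) hτA₁) V₁ V₁)
    (hgU₁ : MapsTo (singularHomology.restrictSelf (h : C(ComplexPoints (fiberOver π s), ComplexPoints (fiberOver π s))) hhA₁) U₁ U₁) [Module.Finite ℚ (singularHomology ℚ ℚ (↥V₁) 2)]
    (hsV2₁ : ∀ v : singularHomology ℚ ℚ (↥V₁) 2, singularHomology.map ℚ ℚ (singularHomology.restrictSelf (singularHomology.restrictSelf (AlgPoints.mapContinuous (L := ℂ) (fiberOverEnd π τ hτπ s)) hτA₁) hsV₁) 2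
      (singularHomology.map ℚ ℚ (singularHomology.restrictSelf (singularHomology.restrictSelf (AlgPoints.mapContinuous (L := ℂ) (fiberOverEnd π τ hτπ s)) hτA₁) hsV₁) 2 v) = v)
    (e₁ : ↥U₁ ≃ₜ OrbitSpace (iotaPunct 4 four_ne_zero (by decide)))
    (heg₁ : singularHomology.map ℚ ℚ ((e₁ : C(↥U₁, OrbitSpace (iotaPunct 4 four_ne_zero (by decide)))).comp (singularHomology.restrictSelf (singularHomology.restrictSelf (h : C(ComplexPoints (fiberOver π s), ComplexPoints (fiberOver π s))) hhA₁) hgU₁)) 2 =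
      singularHomology.map ℚ ℚ (((OrbitSpace.map (negPairPunct 4 * rotatePunct 4 four_ne_zero ⟨ζ, hζ.pow_eq_one⟩)
        (commute_modelPunct_iotaPunct 4 four_ne_zero (by decide) ⟨ζ, hζ.pow_eq_one⟩)) :
          C(OrbitSpace (iotaPunct 4 four_ne_zero (by decide)), OrbitSpace (iotaPunct 4 four_ne_zero (by decide)))).comp (e₁ : C(↥U₁, OrbitSpace (iotaPunct 4 four_ne_zero (by decide))))) 2)
    (hes₁ : singularHomology.map ℚ ℚ ((e₁ : C(↥U₁, OrbitSpace (iotaPunct 4 four_ne_zero (by decide)))).comp (singularHomology.restrictSelf (singularHomology.restrictSelf (AlgPoints.mapContinuous (L := ℂ) (fiberOverEnd π τ hτπ s)) hτA₁) hsU₁)) 2 =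
      singularHomology.map ℚ ℚ (((OrbitSpace.map (rotatePunct 4 four_ne_zero ⟨ζ, hζ.pow_eq_one⟩)
        (commute_rotatePunct_iotaPunct 4 four_ne_zero (by decide) ⟨ζ, hζ.pow_eq_one⟩)) :
          C(OrbitSpace (iotaPunct 4 four_ne_zero (by decide)), OrbitSpace (iotaPunct 4 four_ne_zero (by decide)))).comp (e₁ : C(↥U₁, OrbitSpace (iotaPunct 4 four_ne_zero (by decide))))) 2)
    {U₂ V₂ : Set ↥A₂} (hUo₂ : IsOpen U₂) (hVo₂ : IsOpen V₂) (hUV₂ : U₂ ∪ V₂ = univ)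
    (hI₁₂ : IsZero (singularHomology ℚ ℚ ↥(U₂ ∩ V₂) 2)) (hI₀₂ : IsZero (singularHomology ℚ ℚ ↥(U₂ ∩ V₂) 1))
    (hsU₂ : MapsTo (singularHomology.restrictSelf (AlgPoints.mapContinuous (L := ℂ) (fiberOverEnd π τ hτπ s)) hτA₂) U₂ U₂) (hsV₂ : MapsTo (singularHomology.restrictSelf (AlgPoints.mapContinuous (L := ℂ) (fiberOverEnd π τ hτπ s)) hτA₂) V₂ V₂)
    (hgU₂ : MapsTo (singularHomology.restrictSelf (h : C(ComplexPoints (fiberOver π s), ComplexPoints (fiberOver π s))) hhA₂) U₂ U₂) [Module.Finite ℚ (singularHomology ℚ ℚ (↥V₂) 2)]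
    (hsV2₂ : ∀ v : singularHomology ℚ ℚ (↥V₂) 2, singularHomology.map ℚ ℚ (singularHomology.restrictSelf (singularHomology.restrictSelf (AlgPoints.mapContinuous (L := ℂ) (fiberOverEnd π τ hτπ s)) hτA₂) hsV₂) 2
      (singularHomology.map ℚ ℚ (singularHomology.restrictSelf (singularHomology.restrictSelf (AlgPoints.mapContinuous (L := ℂ) (fiberOverEnd π τ hτπ s)) hτA₂) hsV₂) 2 v) = v)
    (e₂ : ↥U₂ ≃ₜ OrbitSpace (iotaPunct 4 four_ne_zero (by decide)))
    (heg₂ : singularHomology.map ℚ ℚ ((e₂ : C(↥U₂, OrbitSpace (iotaPunct 4 four_ne_zero (by decide)))).comp (singularHomology.restrictSelf (singularHomology.restrictSelf (h : C(ComplexPoints (fiberOver π s), ComplexPoints (fiberOver π s))) hhA₂) hgU₂)) 2 =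
      singularHomology.map ℚ ℚ (((OrbitSpace.map (negPairPunct 4 * rotatePunct 4 four_ne_zero ⟨ζ, hζ.pow_eq_one⟩)
        (commute_modelPunct_iotaPunct 4 four_ne_zero (by decide) ⟨ζ, hζ.pow_eq_one⟩)) :
          C(OrbitSpace (iotaPunct 4 four_ne_zero (by decide)), OrbitSpace (iotaPunct 4 four_ne_zero (by decide)))).comp (e₂ : C(↥U₂, OrbitSpace (iotaPunct 4 four_ne_zero (by decide))))) 2)
    (hes₂ : singularHomology.map ℚ ℚ ((e₂ : C(↥U₂, OrbitSpace (iotaPunct 4 four_ne_zero (by decide)))).comp ((singularHomology.restrictSelf (singularHomology.restrictSelf (AlgPoints.mapContinuous (L := ℂ) (fiberOverEnd π τ hτπ s)) hτA₂) hsU₂).comp ((singularHomology.restrictSelf (singularHomology.restrictSelf (AlgPoints.mapContinuous (L := ℂ) (fiberOverEnd π τ hτπ s)) hτA₂) hsU₂).comp (singularHomology.restrictSelf (singularHomology.restrictSelf (AlgPoints.mapContinuous (L := ℂ) (fiberOverEnd π τ hτπ s)) hτA₂) hsU₂)))) 2 =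
      singularHomology.map ℚ ℚ (((OrbitSpace.map (rotatePunct 4 four_ne_zero ⟨ζ, hζ.pow_eq_one⟩)
        (commute_rotatePunct_iotaPunct 4 four_ne_zero (by decide) ⟨ζ, hζ.pow_eq_one⟩)) :
          C(OrbitSpace (iotaPunct 4 four_ne_zero (by decide)), OrbitSpace (iotaPunct 4 four_ne_zero (by decide)))).comp (e₂ : C(↥U₂, OrbitSpace (iotaPunct 4 four_ne_zero (by decide))))) 2) :
    let Xs := fiberOver π s
    let hXs : IsSmoothProjective 2 Xs := hπ.isSmoothProjective s
    let A : bettiCohomology Xs 2 →ₗ[ℚ] bettiCohomology Xs 2 := pull (fiberOverEnd π τ hτπ s) 2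
    let B : bettiCohomology Xs 2 →ₗ[ℚ] bettiCohomology Xs 2 := pull (fiberOverEnd π j hjπ s) 2
    let Qf : LinearMap.BilinForm ℚ (bettiCohomology Xs 2) := LinearMap.compr₂ (cup Xs 2 2) (tr hXs (2 + 2))
    let Γ := ratMonodromyGroup π 2 hU ⟨s, Set.mem_univ s⟩
    ∃ γ ∈ Γ, ∃ ℓp ℓm : TensorProduct ℚ ℂ (bettiCohomology Xs 2),
      ℓp ∈ (Module.End.eigenspace (A ^ 2) (-1)).baseChange ℂ ∧ ℓm ∈ (Module.End.eigenspace (A ^ 2) (-1)).baseChange ℂ ∧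
      A.baseChange ℂ ℓp = Complex.I • ℓp ∧ A.baseChange ℂ ℓm = Complex.I • ℓm ∧ (Qf.baseChange ℂ) ℓp (B.baseChange ℂ ℓm) ≠ 0 ∧
      (γ.toLinearMap.baseChange ℂ) ℓp = Complex.I • ℓp ∧ (γ.toLinearMap.baseChange ℂ) ℓm = (-Complex.I) • ℓm ∧
      ∀ x ∈ (Module.End.eigenspace (A ^ 2) (-1)).baseChange ℂ, A.baseChange ℂ x = Complex.I • x →
        (Qf.baseChange ℂ) x (B.baseChange ℂ ℓp) = 0 → (Qf.baseChange ℂ) x (B.baseChange ℂ ℓm) = 0 → (γ.toLinearMap.baseChange ℂ) x = x := by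
  intro Xs hXs A B Qf Γ
  -- finiteness of `H₂` of the model, of `U_k`, of the pieces
  obtain ⟨hdimQ, -, -⟩ := quotientPiece_package_homology hζ
  haveI : Module.Finite ℚ (singularHomology ℚ ℚ (OrbitSpace (iotaPunct 4 four_ne_zero (by decide))) 2) := Module.finite_of_finrank_pos (by rw [hdimQ]; exact two_pos)
  haveI : Module.Finite ℚ (singularHomology ℚ ℚ (↥U₁) 2) := Module.Finite.equiv (singularHomology.mapIso ℚ ℚ e₁ 2).toLinearEquiv.symm
  haveI : Module.Finite ℚ (singularHomology ℚ ℚ (↥U₂) 2) := Module.Finite.equiv (singularHomology.mapIso ℚ ℚ e₂ 2).toLinearEquiv.symm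
  haveI : Module.Finite ℚ (singularHomology ℚ ℚ (↥A₁) 2) := finite_of_mayerVietoris hUo₁ hVo₁ hUV₁ 1 hI₁₁ hI₀₁
  haveI : Module.Finite ℚ (singularHomology ℚ ℚ (↥A₂) 2) := finite_of_mayerVietoris hUo₂ hVo₂ hUV₂ 1 hI₁₂ hI₀₂
  -- `τ⁴ = id` on the second piece
  have hs4 : ∀ x : ↥A₂, (singularHomology.restrictSelf (AlgPoints.mapContinuous (L := ℂ) (fiberOverEnd π τ hτπ s)) hτA₂) ((singularHomology.restrictSelf (AlgPoints.mapContinuous (L := ℂ) (fiberOverEnd π τ hτπ s)) hτA₂)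
      ((singularHomology.restrictSelf (AlgPoints.mapContinuous (L := ℂ) (fiberOverEnd π τ hτπ s)) hτA₂) ((singularHomology.restrictSelf (AlgPoints.mapContinuous (L := ℂ) (fiberOverEnd π τ hτπ s)) hτA₂) x))) = x := fun x =>
    Subtype.ext (mapContinuous_fiberOverEnd_pow_four_apply π hτπ h4 s x)
  obtain ⟨hrank₁, hloc₁⟩ := ballPiece_facts₁ hζ hUo₁ hVo₁ hUV₁ hI₁₁ hI₀₁ _ _ hsU₁ hsV₁ hgU₁ hsV2₁ e₁ heg₁ hes₁
  have hloc₂ := ballPiece_facts₂ hζ hUo₂ hVo₂ hUV₂ hI₁₂ hI₀₂ _ _ hsU₂ hsV₂ hgU₂ hs4 hsV2₂ e₂ heg₂ hes₂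
  exact monodromyBireflection_of_localConfiguration π hτπ hπ h𝒳 hS hjπ h4 hjj hτjτ hU s γ hγΓ hγ1 h hγh hhμ hhτ h1o h2o hBo hcov hdisj hB
    hhA₁ hhA₂ hτA₁ hτA₂ hjA₁ hjA₂ hrank₁.le hloc₁ hloc₂

end Summit.HodgeConjecture.HodgeConjecture.Theorems.Q8MonodromyBireflectionAssembly

end
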